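import Mathlib
import HarnessLib
import Literature.AlgebraicGeometry.Resolution.AffineBlowupIntegral
import Summits.ResolutionOfSingularities.ResolutionOfSingularities.Theorems.WildQuotientsWildQuotientResolutionThirdConeChartMixed
import Summits.ResolutionOfSingularities.ResolutionOfSingularities.Theorems.WildQuotientsWildQuotientResolutionJordanThreeOneBlowup

/-!
# THEOREM T3: one blow-up of the reduced vertex resolves every `μ₃` cone `⅓(1^a,2^b) × 𝔸^c`
(crux stmt-ResolutionOfSingularities-15640 `WildQuotients.WildQuotientResolution`, line `Sketch`;
chain w45c NEXT RUNG R-T: conjecture T3 of res-L1-w45c-idea-2's RT-LADDER v1.2 §5 (kit census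
j270820: 20/20 types `⅓(1^a,2^b) × 𝔸^c`, `a + b ≤ 6`, resolved by ONE reduced-vertex blow-up),
res-L1-w45c-plan-1 GO 2026-08-27T10:03:49Z; vocabulary `ThirdCone.*` (p522660), charts
`…ThirdConeChartCube` (p524492) and `…ThirdConeChartMixed`; [OURS · L1 W4.5c] — NOT a statement of
any manuscript; replaces the role of no printed item. Prover res-L1-w45c-stub-2.)

* `ThirdCone.basicOpen_reesT_le_of_cube` — generic: a cube relation `c_i³ = c_j c_p c_q` puts the chart
  `D₊(c_i t)` inside `D₊(c_j t)`;
* `ThirdCone.isRegular_affineBlowup (k n w)` — `Bl_𝔪 ⅓(w)` is regular for EVERY field `k`, every `n`,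
  every weight `w : Fin n → ZMod 3` (no hypothesis): mixed charts `D₊(x_iy_j t)` and cube charts
  `D₊(x_i³t)`, `D₊(y_j³t)` are affine spaces, every other generator chart `D₊(x_ax_bx_c t)` lies in
  `D₊(x_a³ t)` — `JordanThree.isRegular_affineBlowup_of_charts`;
* `ThirdCone.blowup_regular (k n w) (h : ∃ i, w i ≠ 0)` — regular, integral, proper, birational: the
  uniform one-shot exit of the `μ₃` pieces of every `J_m` (`Third112` = `w := Third112.coneWeight`,
  the `J₅` pieces `⅓(1,1,2,2) × 𝔸¹`, `⅓(1,2,2,2) × 𝔸¹`, `J₆`'s `⅓(1,p̄,1,2,2) × 𝔸¹`, the `μ₃` strata of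
  `J₇`, `J₈`).
-/

-- single-problem summit: the doubled namespace component `ResolutionOfSingularities` is forced
set_option linter.dupNamespace false

noncomputable section

open MvPolynomial IsLocalization AlgebraicGeometry CategoryTheory
open Literature.AlgebraicGeometry.Resolution

namespace Summit.ResolutionOfSingularities.ResolutionOfSingularities.Theorems.WildQuotientResolution.ThirdCone

variable (k : Type) [Field k] (n : ℕ) (w : Fin n → ZMod 3)

universe u

/-! ## Cover: the non-vertex generator charts lie in cube charts -/

/-- **A cube relation puts a chart inside another**: if `c_i³ = c_j c_p c_q` in `R` then
`D₊(c_i t) ≤ D₊(c_j t)` on `Bl_I (Spec R)`, `I = (c)`. [folklore] -/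
theorem basicOpen_reesT_le_of_cube {R : Type u} [CommRing R] {m : ℕ} (c : Fin m → R)
    (i j p q : Fin m) (h : c i ^ 3 = c j * c p * c q) :
    Proj.basicOpen (reesGrading (Ideal.span (Set.range c)))
        (reesT (c i) (Ideal.mem_span_range_self (f := c) (x := i))) ≤
      Proj.basicOpen (reesGrading (Ideal.span (Set.range c)))
        (reesT (c j) (Ideal.mem_span_range_self (f := c) (x := j))) := by
  have hrel : reesT (c i) (Ideal.mem_span_range_self (f := c) (x := i)) ^ 3 =
      reesT (c j) (Ideal.mem_span_range_self (f := c) (x := j)) *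
        reesT (c p) (Ideal.mem_span_range_self (f := c) (x := p)) *
        reesT (c q) (Ideal.mem_span_range_self (f := c) (x := q)) := by
    apply Subtype.ext
    simp only [Subalgebra.coe_pow, Subalgebra.coe_mul, coe_reesT, Polynomial.monomial_pow,
      Polynomial.monomial_mul_monomial, h]
  have e1 := Proj.basicOpen_pow (reesGrading (Ideal.span (Set.range c)))
    (reesT (c i) (Ideal.mem_span_range_self (f := c) (x := i))) 3 (by norm_num)
  rw [← e1, hrel, Proj.basicOpen_mul, Proj.basicOpen_mul]
  exact inf_le_left.trans inf_le_left

/-- `vertexFamily (equivFin v) = vertexGen v`. [OURS · L1 W4.5c] -/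
theorem vertexFamily_equivFin (v : VIdx n w) :
    vertexFamily k n w (Fintype.equivFin (VIdx n w) v) = vertexGen k n w v := by
  simp [vertexFamily]

/-- The cube of a triple generator: `(x_a x_b x_c)³ = x_a³ x_b³ x_c³` on exponents. [folklore] -/
theorem three_smul_triple_exp (a b c : Fin n) :
    3 • (Finsupp.single a 1 + Finsupp.single b 1 + Finsupp.single c 1 : Fin n →₀ ℕ) =
      (Finsupp.single a 1 + Finsupp.single a 1 + Finsupp.single a 1) +
        (Finsupp.single b 1 + Finsupp.single b 1 + Finsupp.single b 1) +
        (Finsupp.single c 1 + Finsupp.single c 1 + Finsupp.single c 1) := by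
  ext t
  simp only [Finsupp.smul_apply, Finsupp.add_apply, smul_eq_mul]
  ring

/-- A triple generator with equal entries is the cube `x_a³`. [folklore] -/
theorem monomial_triple_self (a : Fin n) :
    (monomial (Finsupp.single a 1 + Finsupp.single a 1 + Finsupp.single a 1) (1 : k) :
      MvPolynomial (Fin n) k) = X a ^ 3 := by
  rw [X_pow_eq_monomial, ← Finsupp.single_add, ← Finsupp.single_add]

/-! ## Theorem T3 -/

/-- **Theorem T3 (regularity).** For every field `k`, every `n` and every weight
`w : Fin n → ZMod 3`, the blow-up of the cone `⅓(w) = ThirdCone.cone k n w` (the weight-`0` subalgebra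
of `k[x₁,…,x_n]`; `= ⅓(1^a,2^b) × 𝔸^c`) along the reduced vertex ideal `ThirdCone.vertexIdeal k n w`
is a REGULAR scheme: the charts at the mixed generators `x_iy_j` and at the cubes `x_i³`, `y_j³` are
affine spaces (`isRegularRing_chartRing_mixed`, `isRegularRing_chartRing_cube`), and the chart at any
other generator `x_ax_bx_c` lies in the cube chart `D₊(x_a³t)` (`(x_ax_bx_c t)³ = (x_a³t)(x_b³t)(x_c³t)`).
[OURS · L1 W4.5c] — conjecture T3 of res-L1-w45c-idea-2's RT-LADDER v1.2 §5, all `(a,b,c)` at once. -/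
theorem isRegular_affineBlowup : Scheme.IsRegular (affineBlowup (vertexIdeal k n w)) := by
  classical
  show Scheme.IsRegular (affineBlowup (Ideal.span (Set.range (vertexFamily k n w))))
  refine JordanThree.isRegular_affineBlowup_of_charts (vertexFamily k n w) fun i' => ?_
  obtain ⟨v, rfl⟩ := (Fintype.equivFin (VIdx n w)).surjective i'
  have hval : ∀ u : VIdx n w, ((vertexFamily k n w (Fintype.equivFin (VIdx n w) u) : cone k n w) :
      MvPolynomial (Fin n) k) = monomial (vertexExp n w u) 1 := fun u => by
    rw [vertexFamily_equivFin]; rfl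
  have hcube : ∀ a b c : Fin n,
      (monomial (Finsupp.single a 1 + Finsupp.single b 1 + Finsupp.single c 1) (1 : k) :
          MvPolynomial (Fin n) k) ^ 3 =
        monomial (Finsupp.single a 1 + Finsupp.single a 1 + Finsupp.single a 1) 1 *
          monomial (Finsupp.single b 1 + Finsupp.single b 1 + Finsupp.single b 1) 1 *
          monomial (Finsupp.single c 1 + Finsupp.single c 1 + Finsupp.single c 1) 1 := by
    intro a b c
    rw [monomial_pow, monomial_mul, monomial_mul, one_pow, one_mul, one_mul, three_smul_triple_exp]
  rcases v with ⟨a, b, c⟩ | ⟨a, b, c⟩ | ⟨a, b⟩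
  · refine ⟨Fintype.equivFin (VIdx n w) (Sum.inl (a, a, a)),
      isRegularRing_chartRing_cube k n w _ a.1 (by rw [a.2]; decide)
        (by rw [hval]; exact monomial_triple_self k n a.1),
      basicOpen_reesT_le_of_cube (vertexFamily k n w) _ _
        (Fintype.equivFin (VIdx n w) (Sum.inl (b, b, b)))
        (Fintype.equivFin (VIdx n w) (Sum.inl (c, c, c))) (Subtype.ext ?_)⟩
    simp only [Subalgebra.coe_pow, Subalgebra.coe_mul, hval]
    exact hcube a.1 b.1 c.1
  · refine ⟨Fintype.equivFin (VIdx n w) (Sum.inr (Sum.inl (a, a, a))),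
      isRegularRing_chartRing_cube k n w _ a.1 (by rw [a.2]; decide)
        (by rw [hval]; exact monomial_triple_self k n a.1),
      basicOpen_reesT_le_of_cube (vertexFamily k n w) _ _
        (Fintype.equivFin (VIdx n w) (Sum.inr (Sum.inl (b, b, b))))
        (Fintype.equivFin (VIdx n w) (Sum.inr (Sum.inl (c, c, c)))) (Subtype.ext ?_)⟩
    simp only [Subalgebra.coe_pow, Subalgebra.coe_mul, hval]
    exact hcube a.1 b.1 c.1
  · refine ⟨Fintype.equivFin (VIdx n w) (Sum.inr (Sum.inr (a, b))),
      isRegularRing_chartRing_mixed k n w _ a.1 b.1 a.2 b.2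
        (by rw [hval, vertexExp, X, X, monomial_mul, one_mul]),
      le_rfl⟩

/-- The vertex ideal is non-zero as soon as some variable has non-zero weight. [OURS · L1 W4.5c] -/
theorem vertexIdeal_ne_bot (h : ∃ i, w i ≠ 0) : vertexIdeal k n w ≠ ⊥ := by
  classical
  obtain ⟨i, hi⟩ := h
  intro h0
  have key : ∀ v : VIdx n w, vertexGen k n w v = 0 := fun v =>
    (Ideal.span_eq_bot.mp h0) _ (by rw [range_vertexFamily]; exact ⟨v, rfl⟩)
  have hne : ∀ v : VIdx n w, False := fun v => by
    have := congrArg (fun x : cone k n w => (x : MvPolynomial (Fin n) k)) (key v)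
    simp only [coe_vertexGen, ZeroMemClass.coe_zero, monomial_eq_zero] at this
    exact one_ne_zero this
  rcases eq_one_or_eq_two_of_ne_zero (w i) hi with h1 | h2
  · exact hne (Sum.inl (⟨i, h1⟩, ⟨i, h1⟩, ⟨i, h1⟩))
  · exact hne (Sum.inr (Sum.inl (⟨i, h2⟩, ⟨i, h2⟩, ⟨i, h2⟩)))

/-- **Theorem T3.** For every field `k`, every `n` and every weight `w : Fin n → ZMod 3` with at least
one non-passenger variable, ONE blow-up — of the reduced vertex `ThirdCone.vertexIdeal` — resolves the
cone `⅓(w) = ⅓(1^a,2^b) × 𝔸^c`: `Bl_𝔪 ⅓(w)` is regular and integral, and `Bl_𝔪 ⅓(w) → ⅓(w)` is proper and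
birational. Uniform in `(a,b,c)`: covers `Third112` (V4U piece 0), both `μ₃` pieces of `J₅` and the
`μ₃` strata of `J₆`, `J₇`, `J₈` (RT-LADDER §1/§3/§4). [OURS · L1 W4.5c] -/
theorem blowup_regular (h : ∃ i, w i ≠ 0) :
    Scheme.IsRegular (affineBlowup (vertexIdeal k n w)) ∧ IsIntegral (affineBlowup (vertexIdeal k n w)) ∧
      IsProper (affineBlowup.π (vertexIdeal k n w)) ∧ IsBirational (affineBlowup.π (vertexIdeal k n w)) := by
  have hne := vertexIdeal_ne_bot k n w h
  have hfg : (vertexIdeal k n w).FG := Submodule.fg_span (Set.finite_range (vertexFamily k n w))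
  exact ⟨isRegular_affineBlowup k n w, affineBlowup.isIntegral hne, affineBlowup.isProper_of_fg _ hfg,
    affineBlowup.isBirational hne⟩

end Summit.ResolutionOfSingularities.ResolutionOfSingularities.Theorems.WildQuotientResolution.ThirdCone

end
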